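import Summits.CriticalPhenomena.PercolationContinuityZ3.Theorems.AdditiveGluing.Negative.CertWeighted
import Literature.Probability.LatticeModels.ProdBernoulliIndependence
import HarnessLib

/-! # Crux `PercNearOneGluing.AdditiveGluing` (stmt-CriticalPhenomena-4576) — the finger-deletion step FQ♯ is FALSE at a finger wired to `b`:
# a certified weighted counterexample on six vertices (seat (b) V⁺-form, `png-dp-vplus`, gen 8)

Support file (`--supports stmt-CriticalPhenomena-4576`); no definitions of mathematical content (the `def`s are witness data and computable
checkers), no named facts, no sorries, standard axioms (the arithmetic is kernel `decide`, not `native_decide`).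

The reduction `fingerML3_of_FQsharp` (…AdditiveGluingFQsharpReduction.lean) derives the registered stub `stub_fingerML3_vp` from the step

  (FQ♯)  `Δ_K(F_f) − μ_K(R_{F_f})·h ≥ μ_K(R_{F_f}ᶜ)·max(0, h − h')`

(`F_f` = the pairs of one finger `f` to the relays, `R_{F_f}` = "some pair of `F_f` open", `Δ_K(F) = μ_K(R_F ∩ {d↮N} ∩ ⋃_{v∈N}{v↔b}) −
μ_K(R_F ∩ {d↮N} ∩ {d↔b})`, `h` = the least hypothesis slack `μ_K(a↔b) − μ_K(d↔b)` over the active contact relays `a ≠ b`, `h'` = the same for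
the weighting with the pairs of `f` killed), assumed at every stage for SOME finger, for blocks WITHOUT pairs to `b`.  The ttrl census
(run/shared/lean/ttrl/setG/QSHARP.md; 509 M exact instances) found FQ♯ violated in exactly 53 designations, all at fingers WIRED TO `b`.

**THIS FILE CERTIFIES THE SMALLEST SUCH VIOLATION** (kernel reduction, exact rationals): vertices `Fin 6`, `b = 0`, `d = 1`, block `N = {2, 3}`,
relays `A = {0, 1, 4, 5}`; weights `K(0,2) = 3/4` (the finger `2` is wired to `b`), `K(0,4) = 1/2`, `K(1,4) = 31/32`, `K(2,5) = 3/4`,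
`K(3,4) = 31/32`, `K(3,5) = 1/2`, all other pairs `0`; finger `f = 2`.  Then `μ_K(4↔b) = 1303/2048 < μ_K(5↔b) = 1369/2048`,
`μ_K(d↔b) = 40393/65536`, so `h = 1303/65536`; killing the pairs of `f` leaves `μ(4↔b) = 1/2`, `μ(5↔b) = 31/128`, `μ(d↔b) = 31/64`, so
`h' = −31/128`; `Δ_K(F_f) = 1233/32768 − 93/32768 = 285/8192`, `μ_K(R_{F_f}) = 15/16`; and
`Δ − μ(R)·h − μ(Rᶜ)·max(0, h − h') = −15/65536 < 0`.
So the "no pair `N–b`" proviso of `fingerML3_of_FQsharp` cannot be dropped with the step stated for an ARBITRARY active finger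
(`not_FQsharp_bFinger`).  Conjecture G, L1/L2 and FQ♯ at fingers not wired to `b` are NOT touched by this witness.

Contents: an evaluation lemma for events read on the EDGE LIST of a sub-configuration (`real_eq_wcountL`, needed because `R_{F_f}` is an
edge event), the witness (`witFQ`, `witFQ'`), the identification of the killed weighting (`killWeight_eq`), the events as `Bool` tests,
the kernel arithmetic (`facts`), and the negation `not_FQsharp_bFinger` (the witness instantiated inside its proof).
[cite: KozmaNitzan2024, Thm 4 and Lemma 5 (§3.2, pp. 12–14)]
-/

namespace Summit.CriticalPhenomena.PercolationContinuityZ3.Theorems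

open MeasureTheory Set
open Literature.Probability.LatticeModels Literature.Probability.Percolation
open Summit.CriticalPhenomena.PercolationContinuityZ3.Theorems.AdditiveGluing.Negative.Cert

noncomputable section
open Classical

namespace FQsharpBFingerCex

variable {n : ℕ}

/-- **Evaluation lemma (edge list).** Under `prodBernoulli (wOfList l)` the probability of any event whose per-configuration indicator
is a `Bool` test on the LIST OF OPEN PAIRS equals the exact weighted count of the test over the `2^m` sub-configurations. [folklore] -/
theorem real_eq_wcountL {l : List (Fin n × Fin n × ℚ)} (hnd : (wPairs l).Nodup)
    (hq : ∀ e ∈ l, 0 ≤ e.2.2 ∧ e.2.2 ≤ 1) (g : List (Fin n × Fin n) → Bool) (D : Set (Set (Sym2 (Fin n))))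
    (hgD : ∀ ω : List (Fin n × Fin n), g ω = true ↔ (↑(Eset ω) : Set (Sym2 (Fin n))) ∈ D) :
    (prodBernoulli (wOfList l)).real D = ((((wsubs l).map fun c => if g c.1 then c.2 else 0).sum : ℚ) : ℝ) := by
  classical
  rw [prodBernoulli_real_eq_wsum hnd hq D, wsum, Rat.cast_list_sum, List.map_map]
  congr 1
  refine List.map_congr_left fun c _ => ?_
  simp only [Function.comp_apply]
  by_cases hP : (↑(Eset c.1) : Set (Sym2 (Fin n))) ∈ D
  · rw [if_pos ((hgD c.1).2 hP), if_pos hP, mul_one]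
  · rw [if_neg (fun h => hP ((hgD c.1).1 h)), if_neg hP, mul_zero, Rat.cast_zero]

/-! ### The witness -/

/-- The witness weights on `Fin 6` (`b = 0`, `d = 1`, `N = {2,3}`, relays `A = {0,1,4,5}`):
`K(0,2) = 3/4, K(0,4) = 1/2, K(1,4) = 31/32, K(2,5) = 3/4, K(3,4) = 31/32, K(3,5) = 1/2`. -/
def witFQ : List (Fin 6 × Fin 6 × ℚ) :=
  [(0, 2, 3/4), (0, 4, 1/2), (1, 4, 31/32), (2, 5, 3/4), (3, 4, 31/32), (3, 5, 1/2)]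

/-- The witness with the pairs of the finger `2` killed. -/
def witFQ' : List (Fin 6 × Fin 6 × ℚ) :=
  [(0, 4, 1/2), (1, 4, 31/32), (3, 4, 31/32), (3, 5, 1/2)]

/-- The listed pairs of the witness are distinct. [this file] -/
theorem witFQ_nodup : (wPairs witFQ).Nodup := by decide

/-- The witness weights lie in `[0, 1]`. [this file] -/
theorem witFQ_weights : ∀ e ∈ witFQ, 0 ≤ e.2.2 ∧ e.2.2 ≤ 1 := by
  intro e he
  simp only [witFQ, List.mem_cons, List.not_mem_nil, or_false] at he
  rcases he with rfl | rfl | rfl | rfl | rfl | rfl <;> norm_num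

/-- The listed pairs of the killed list are distinct. [this file] -/
theorem witFQ'_nodup : (wPairs witFQ').Nodup := by decide

/-- The killed weights lie in `[0, 1]`. [this file] -/
theorem witFQ'_weights : ∀ e ∈ witFQ', 0 ≤ e.2.2 ∧ e.2.2 ≤ 1 := by
  intro e he
  simp only [witFQ', List.mem_cons, List.not_mem_nil, or_false] at he
  rcases he with rfl | rfl | rfl | rfl <;> norm_num

/-- **Killing the pairs of the finger `2` to the relays gives `wOfList witFQ'`.** [this file] -/
theorem killWeight_eq :
    (fun e' : Sym2 (Fin 6) => if (∃ a ∈ ({0, 1, 4, 5} : Finset (Fin 6)), e' = s((2 : Fin 6), a)) then (0 : unitInterval)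
      else wOfList witFQ e') = wOfList witFQ' := by
  funext x
  induction x using Sym2.ind with
  | _ i j =>
    fin_cases i <;> fin_cases j <;> simp [wOfList, witFQ, witFQ', mkE]

/-! ### The events as `Bool` tests -/

/-- some pair of the finger `2` to a relay is open (read on the edge list). -/
def rfB (ω : List (Fin 6 × Fin 6)) : Bool :=
  decide (∃ a ∈ ({0, 1, 4, 5} : Finset (Fin 6)), s((2 : Fin 6), a) ∈ Eset ω)

/-- `d ↮ N` and some block vertex `↔ b` (read on the reach table). -/
def muB (tb : List ℕ) : Bool :=
  decide ((∀ x ∈ ({2, 3} : Finset (Fin 6)), (tb.getD ((1 : Fin 6) : ℕ) 0).testBit (x : ℕ) = false) ∧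
    ∃ v ∈ ({2, 3} : Finset (Fin 6)), (tb.getD (v : ℕ) 0).testBit ((0 : Fin 6) : ℕ) = true)

/-- `d ↮ N` and `d ↔ b` (read on the reach table). -/
def mxB (tb : List ℕ) : Bool :=
  decide ((∀ x ∈ ({2, 3} : Finset (Fin 6)), (tb.getD ((1 : Fin 6) : ℕ) 0).testBit (x : ℕ) = false) ∧
    (tb.getD ((1 : Fin 6) : ℕ) 0).testBit ((0 : Fin 6) : ℕ) = true)

/-- Exact count of `R_f ∩ ({d↮N} ∩ ⋃_{v∈N}{v↔b})`. -/
def cntRMU : ℚ := ((wsubs witFQ).map fun c => if rfB c.1 && muB (reachTable 6 c.1) then c.2 else 0).sum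

/-- Exact count of `R_f ∩ ({d↮N} ∩ {d↔b})`. -/
def cntRMX : ℚ := ((wsubs witFQ).map fun c => if rfB c.1 && mxB (reachTable 6 c.1) then c.2 else 0).sum

/-- Exact count of `R_f`. -/
def cntR : ℚ := ((wsubs witFQ).map fun c => if rfB c.1 then c.2 else 0).sum

/-- Exact count of `R_fᶜ`. -/
def cntRc : ℚ := ((wsubs witFQ).map fun c => if !(rfB c.1) then c.2 else 0).sum

/-- `μ_K(R_f ∩ ({d↮N} ∩ ⋃_{v∈N}{v↔b})) = cntRMU`. [this file] -/
theorem real_RMU :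
    (prodBernoulli (wOfList witFQ)).real
        ({ω : Set (Sym2 (Fin 6)) | ∃ e ∈ ({0, 1, 4, 5} : Finset (Fin 6)).image (fun a : Fin 6 => s((2 : Fin 6), a)), e ∈ ω} ∩
          ({ω : BondConfig (Fin 6) | ∀ x ∈ (↑({2, 3} : Finset (Fin 6)) : Set (Fin 6)), ¬ (openGraph ω).Reachable 1 x} ∩
            ⋃ v ∈ ({2, 3} : Finset (Fin 6)), openConn v 0)) = (cntRMU : ℝ) := by
  refine real_eq_wcountL witFQ_nodup witFQ_weights (fun ω => rfB ω && muB (reachTable 6 ω)) _ fun ω => ?_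
  simp only [Bool.and_eq_true, rfB, muB, decide_eq_true_eq, Set.mem_inter_iff, Set.mem_setOf_eq, Finset.mem_coe, Finset.mem_image,
    Bool.eq_false_iff, ne_eq, testBit_reachTable_iff_mem_openConn, openConn, Set.mem_iUnion, exists_prop, Finset.mem_coe]
  constructor
  · rintro ⟨⟨a, ha, he⟩, hM, hU⟩
    exact ⟨⟨s((2 : Fin 6), a), ⟨a, ha, rfl⟩, he⟩, hM, hU⟩
  · rintro ⟨⟨e, ⟨a, ha, rfl⟩, he⟩, hM, hU⟩
    exact ⟨⟨a, ha, he⟩, hM, hU⟩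

/-- `μ_K(R_f ∩ ({d↮N} ∩ {d↔b})) = cntRMX`. [this file] -/
theorem real_RMX :
    (prodBernoulli (wOfList witFQ)).real
        ({ω : Set (Sym2 (Fin 6)) | ∃ e ∈ ({0, 1, 4, 5} : Finset (Fin 6)).image (fun a : Fin 6 => s((2 : Fin 6), a)), e ∈ ω} ∩
          ({ω : BondConfig (Fin 6) | ∀ x ∈ (↑({2, 3} : Finset (Fin 6)) : Set (Fin 6)), ¬ (openGraph ω).Reachable 1 x} ∩
            openConn (1 : Fin 6) 0)) = (cntRMX : ℝ) := by
  refine real_eq_wcountL witFQ_nodup witFQ_weights (fun ω => rfB ω && mxB (reachTable 6 ω)) _ fun ω => ?_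
  simp only [Bool.and_eq_true, rfB, mxB, decide_eq_true_eq, Set.mem_inter_iff, Set.mem_setOf_eq, Finset.mem_coe, Finset.mem_image,
    Bool.eq_false_iff, ne_eq, testBit_reachTable_iff_mem_openConn, openConn]
  constructor
  · rintro ⟨⟨a, ha, he⟩, hM, hX⟩
    exact ⟨⟨s((2 : Fin 6), a), ⟨a, ha, rfl⟩, he⟩, hM, hX⟩
  · rintro ⟨⟨e, ⟨a, ha, rfl⟩, he⟩, hM, hX⟩
    exact ⟨⟨a, ha, he⟩, hM, hX⟩

/-- `μ_K(R_f) = cntR`. [this file] -/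
theorem real_R :
    (prodBernoulli (wOfList witFQ)).real
        {ω : Set (Sym2 (Fin 6)) | ∃ e ∈ ({0, 1, 4, 5} : Finset (Fin 6)).image (fun a : Fin 6 => s((2 : Fin 6), a)), e ∈ ω} =
      (cntR : ℝ) := by
  refine real_eq_wcountL witFQ_nodup witFQ_weights rfB _ fun ω => ?_
  simp only [rfB, decide_eq_true_eq, Set.mem_setOf_eq, Finset.mem_coe, Finset.mem_image]
  constructor
  · rintro ⟨a, ha, he⟩
    exact ⟨s((2 : Fin 6), a), ⟨a, ha, rfl⟩, he⟩
  · rintro ⟨e, ⟨a, ha, rfl⟩, he⟩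
    exact ⟨a, ha, he⟩

/-- `μ_K(R_fᶜ) = cntRc`. [this file] -/
theorem real_Rc :
    (prodBernoulli (wOfList witFQ)).real
        ({ω : Set (Sym2 (Fin 6)) | ∃ e ∈ ({0, 1, 4, 5} : Finset (Fin 6)).image (fun a : Fin 6 => s((2 : Fin 6), a)), e ∈ ω}ᶜ :
          Set (BondConfig (Fin 6))) = (cntRc : ℝ) := by
  refine real_eq_wcountL witFQ_nodup witFQ_weights (fun ω => !(rfB ω)) _ fun ω => ?_
  simp only [Bool.not_eq_true', rfB, decide_eq_false_iff_not, Set.mem_compl_iff, Set.mem_setOf_eq, Finset.mem_coe, Finset.mem_image,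
    not_exists, not_and]
  constructor
  · intro h e ⟨a, ha, hea⟩ he
    exact h a ha (hea ▸ he)
  · intro h a ha he
    exact h _ ⟨a, ha, rfl⟩ he

/-! ### The arithmetic (exact rational counts over `2⁶` resp. `2⁴` configurations, kernel `decide`) -/

/-- The facts: the structural data of the instance (`4` is the weakest contact of `K`, `5` the weakest active contact of the killed
weighting), and the violated step: with `h = μ_K(4↔b) − μ_K(d↔b)` and `h' = μ_{K'}(5↔b) − μ_{K'}(d↔b)`,
`cntRMU − cntRMX − cntR·h < cntRc·max(0, h − h')`. [this file] -/
theorem facts :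
    wConn (wtabs 6 witFQ) 4 0 ≤ wConn (wtabs 6 witFQ) 5 0 ∧
    wConn (wtabs 6 witFQ') 5 0 ≤ wConn (wtabs 6 witFQ') 4 0 ∧
    cntRMU - cntRMX - cntR * (wConn (wtabs 6 witFQ) 4 0 - wConn (wtabs 6 witFQ) 1 0) <
      cntRc * max 0 ((wConn (wtabs 6 witFQ) 4 0 - wConn (wtabs 6 witFQ) 1 0) -
        (wConn (wtabs 6 witFQ') 5 0 - wConn (wtabs 6 witFQ') 1 0)) := by
  decide +kernel

end FQsharpBFingerCex

open FQsharpBFingerCex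

/-- **The finger-deletion step FQ♯ is FALSE at a finger wired to `b`.**  The negated statement is the step assumed by
`fingerML3_of_FQsharp` at the first stage (`D = ∅`), for an ARBITRARY active finger `f` (in particular one with a positive pair to `b`):
stub setting with no pairs `N–d` and no inner pairs, `h` the least slack `μ_K(a↔b) − μ_K(d↔b)` over the active contact relays `a ≠ b`,
`h'` the least such slack after killing the pairs of `f`, and the claim `Δ_K(F_f) − μ_K(R_{F_f})·h ≥ μ_K(R_{F_f}ᶜ)·max(0, h − h')`.  It fails
at the six-vertex witness `witFQ` with `f = 2` (margin `−15/65536`; `FQsharpBFingerCex.facts`).  FQ♯ at fingers NOT wired to `b`, L1/L2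
and conjecture G are not refuted. [this file] -/
theorem not_FQsharp_bFinger :
    ¬ (∀ (n : ℕ) (K : Sym2 (Fin n) → unitInterval) (A N : Finset (Fin n)) (d b f : Fin n) (h h' : ℝ),
      b ∈ A → d ∈ A → Disjoint N A → f ∈ N →
      (∀ v ∈ N, (K s(v, d) : ℝ) = 0) → (∀ v ∈ N, ∀ v' ∈ N, v ≠ v' → (K s(v, v') : ℝ) = 0) →
      (∀ v ∈ N, ∀ y : Fin n, y ∉ A → y ∉ N → (K s(v, y) : ℝ) = 0) →
      (∃ a ∈ A, a ≠ b ∧ (K s(f, a) : ℝ) ≠ 0) →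
      ((∀ a ∈ A, a ≠ b → (∃ v ∈ N, (K s(v, a) : ℝ) ≠ 0) →
          h ≤ (prodBernoulli K).real (openConn a b) - (prodBernoulli K).real (openConn d b)) ∧
        (∃ a ∈ A, a ≠ b ∧ (∃ v ∈ N, (K s(v, a) : ℝ) ≠ 0) ∧
          h = (prodBernoulli K).real (openConn a b) - (prodBernoulli K).real (openConn d b))) →
      ((∀ a ∈ A, a ≠ b → (∃ v ∈ N, v ≠ f ∧ (K s(v, a) : ℝ) ≠ 0) →
          h' ≤ (prodBernoulli (fun e' : Sym2 (Fin n) => if (∃ a' ∈ A, e' = s(f, a')) then (0 : unitInterval) else K e')).real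
                  (openConn a b) -
                (prodBernoulli (fun e' : Sym2 (Fin n) => if (∃ a' ∈ A, e' = s(f, a')) then (0 : unitInterval) else K e')).real
                  (openConn d b)) ∧
        (∃ a ∈ A, a ≠ b ∧ (∃ v ∈ N, v ≠ f ∧ (K s(v, a) : ℝ) ≠ 0) ∧
          h' = (prodBernoulli (fun e' : Sym2 (Fin n) => if (∃ a' ∈ A, e' = s(f, a')) then (0 : unitInterval) else K e')).real
                  (openConn a b) -
                (prodBernoulli (fun e' : Sym2 (Fin n) => if (∃ a' ∈ A, e' = s(f, a')) then (0 : unitInterval) else K e')).real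
                  (openConn d b))) →
      (prodBernoulli K).real ({ω : Set (Sym2 (Fin n)) | ∃ e ∈ A.image (fun a : Fin n => s(f, a)), e ∈ ω} ∩
            ({ω : BondConfig (Fin n) | ∀ x ∈ (↑N : Set (Fin n)), ¬ (openGraph ω).Reachable d x} ∩ ⋃ v ∈ N, openConn v b)) -
          (prodBernoulli K).real ({ω : Set (Sym2 (Fin n)) | ∃ e ∈ A.image (fun a : Fin n => s(f, a)), e ∈ ω} ∩
            ({ω : BondConfig (Fin n) | ∀ x ∈ (↑N : Set (Fin n)), ¬ (openGraph ω).Reachable d x} ∩ openConn d b)) -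
          (prodBernoulli K).real {ω : Set (Sym2 (Fin n)) | ∃ e ∈ A.image (fun a : Fin n => s(f, a)), e ∈ ω} * h ≥
        (prodBernoulli K).real ({ω : Set (Sym2 (Fin n)) | ∃ e ∈ A.image (fun a : Fin n => s(f, a)), e ∈ ω}ᶜ :
            Set (BondConfig (Fin n))) * max 0 (h - h')) := by
  intro hall
  obtain ⟨h45, h54', hviol⟩ := facts
  -- the two-point functions of the witness and of the killed weighting, as exact rationals
  have hτ4 : (prodBernoulli (wOfList witFQ)).real (openConn (4 : Fin 6) 0) = (wConn (wtabs 6 witFQ) 4 0 : ℝ) :=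
    real_openConn_eq_wConn witFQ_nodup witFQ_weights 4 0
  have hτ5 : (prodBernoulli (wOfList witFQ)).real (openConn (5 : Fin 6) 0) = (wConn (wtabs 6 witFQ) 5 0 : ℝ) :=
    real_openConn_eq_wConn witFQ_nodup witFQ_weights 5 0
  have hτ1 : (prodBernoulli (wOfList witFQ)).real (openConn (1 : Fin 6) 0) = (wConn (wtabs 6 witFQ) 1 0 : ℝ) :=
    real_openConn_eq_wConn witFQ_nodup witFQ_weights 1 0
  have hτ'4 : (prodBernoulli (fun e' : Sym2 (Fin 6) => if (∃ a' ∈ ({0, 1, 4, 5} : Finset (Fin 6)), e' = s((2 : Fin 6), a'))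
      then (0 : unitInterval) else wOfList witFQ e')).real (openConn (4 : Fin 6) 0) = (wConn (wtabs 6 witFQ') 4 0 : ℝ) := by
    rw [killWeight_eq]; exact real_openConn_eq_wConn witFQ'_nodup witFQ'_weights 4 0
  have hτ'5 : (prodBernoulli (fun e' : Sym2 (Fin 6) => if (∃ a' ∈ ({0, 1, 4, 5} : Finset (Fin 6)), e' = s((2 : Fin 6), a'))
      then (0 : unitInterval) else wOfList witFQ e')).real (openConn (5 : Fin 6) 0) = (wConn (wtabs 6 witFQ') 5 0 : ℝ) := by
    rw [killWeight_eq]; exact real_openConn_eq_wConn witFQ'_nodup witFQ'_weights 5 0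
  have hτ'1 : (prodBernoulli (fun e' : Sym2 (Fin 6) => if (∃ a' ∈ ({0, 1, 4, 5} : Finset (Fin 6)), e' = s((2 : Fin 6), a'))
      then (0 : unitInterval) else wOfList witFQ e')).real (openConn (1 : Fin 6) 0) = (wConn (wtabs 6 witFQ') 1 0 : ℝ) := by
    rw [killWeight_eq]; exact real_openConn_eq_wConn witFQ'_nodup witFQ'_weights 1 0
  have h45R : (wConn (wtabs 6 witFQ) 4 0 : ℝ) ≤ (wConn (wtabs 6 witFQ) 5 0 : ℝ) := by exact_mod_cast h45
  have h54R : (wConn (wtabs 6 witFQ') 5 0 : ℝ) ≤ (wConn (wtabs 6 witFQ') 4 0 : ℝ) := by exact_mod_cast h54'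
  -- no block vertex has a positive pair to `d = 1`
  have hnod : ∀ v ∈ ({2, 3} : Finset (Fin 6)), (wOfList witFQ s(v, 1) : ℝ) = 0 := by
    intro v hv
    simp only [Finset.mem_insert, Finset.mem_singleton] at hv
    rcases hv with rfl | rfl <;> simp [wOfList, witFQ, mkE]
  have key := hall 6 (wOfList witFQ) {0, 1, 4, 5} {2, 3} 1 0 2
    ((wConn (wtabs 6 witFQ) 4 0 - wConn (wtabs 6 witFQ) 1 0 : ℚ) : ℝ)
    ((wConn (wtabs 6 witFQ') 5 0 - wConn (wtabs 6 witFQ') 1 0 : ℚ) : ℝ)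
    (by decide) (by decide) (by decide) (by decide) hnod
    (by
      intro v hv v' hv' hvv'
      simp only [Finset.mem_insert, Finset.mem_singleton] at hv hv'
      rcases hv with rfl | rfl <;> rcases hv' with rfl | rfl <;> first | exact absurd rfl hvv' | simp [wOfList, witFQ, mkE])
    (by
      intro v _ y hyA hyN
      exfalso
      revert y
      decide)
    (by
      refine ⟨5, by decide, by decide, ?_⟩
      have h25 : wOfList witFQ s((2 : Fin 6), 5) = Set.projIcc (0 : ℝ) 1 zero_le_one ((3/4 : ℚ) : ℝ) := by
        simp [wOfList, witFQ, mkE]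
      rw [h25]
      norm_num [Set.projIcc])
    (by
      refine ⟨?_, ⟨4, by decide, by decide, ⟨3, by decide, ?_⟩, ?_⟩⟩
      · intro a ha hab hact
        simp only [Finset.mem_insert, Finset.mem_singleton] at ha
        rcases ha with rfl | rfl | rfl | rfl
        · exact absurd rfl hab
        · exfalso
          obtain ⟨v, hv, hne⟩ := hact
          exact hne (hnod v hv)
        · rw [hτ4, hτ1]; push_cast; linarith
        · rw [hτ5, hτ1]; push_cast; linarith
      · have h34 : wOfList witFQ s((3 : Fin 6), 4) = Set.projIcc (0 : ℝ) 1 zero_le_one ((31/32 : ℚ) : ℝ) := by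
          simp [wOfList, witFQ, mkE]
        rw [h34]
        norm_num [Set.projIcc]
      · rw [hτ4, hτ1]; push_cast; ring)
    (by
      refine ⟨?_, ⟨5, by decide, by decide, ⟨3, by decide, by decide, ?_⟩, ?_⟩⟩
      · intro a ha hab hact
        simp only [Finset.mem_insert, Finset.mem_singleton] at ha
        rcases ha with rfl | rfl | rfl | rfl
        · exact absurd rfl hab
        · exfalso
          obtain ⟨v, hv, -, hne⟩ := hact
          exact hne (hnod v hv)
        · rw [hτ'4, hτ'1]; push_cast; linarith
        · rw [hτ'5, hτ'1]; push_cast; linarith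
      · have h35 : wOfList witFQ s((3 : Fin 6), 5) = Set.projIcc (0 : ℝ) 1 zero_le_one ((1/2 : ℚ) : ℝ) := by
          simp [wOfList, witFQ, mkE]
        rw [h35]
        norm_num [Set.projIcc]
      · rw [hτ'5, hτ'1]; push_cast; ring)
  rw [real_RMU, real_RMX, real_R, real_Rc] at key
  have key' : cntRc * max 0 ((wConn (wtabs 6 witFQ) 4 0 - wConn (wtabs 6 witFQ) 1 0) -
        (wConn (wtabs 6 witFQ') 5 0 - wConn (wtabs 6 witFQ') 1 0)) ≤
      cntRMU - cntRMX - cntR * (wConn (wtabs 6 witFQ) 4 0 - wConn (wtabs 6 witFQ) 1 0) := by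
    have := key
    push_cast at this
    exact_mod_cast this
  exact absurd key' (not_le.2 hviol)

end

end Summit.CriticalPhenomena.PercolationContinuityZ3.Theorems
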